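import Summits.BirchSwinnertonDyer.BirchSwinnertonDyer.Theorems.ResidualThetaTransportAtTwoResidualSignedLambdaLowerCMAtTwoStubKzgValueRelation
import Summits.BirchSwinnertonDyer.BirchSwinnertonDyer.Theorems.ResidualThetaTransportAtTwoResidualSignedLambdaLowerCMAtTwoS3BodyOfStations
import Summits.BirchSwinnertonDyer.BirchSwinnertonDyer.Theorems.ResidualThetaTransportAtTwoResidualSignedLambdaLowerCMAtTwoStationE
import HarnessLib

/-!
# Sketch — stub-ideation k3 g30 on `stub_cmLambdaLower` (crux (R≥)ᵖ, stmt-BirchSwinnertonDyer-26074), technique = DECOMPOSITION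

Seat `planner-sidea-stub_cmLambdaLower-3-g30`. Sketch ONLY (Cruxes workfile, not a Theorems proposal); nothing here is registered text;
BSD / (R≥)ᵖ / RSL_g / KZ_g are NOT proved by any of this.

THE CUT. The ∀-form child B `stub_kzgChildB` (kept VERBATIM by onepair v3i and bt26_lambda v8/v9) follows from ONE valued class
(the merged print «Kato 12.5 (1)+(2) at the pins», typer lane) by the slack-invariance station (B≡) (critic row 114 / V169). Row 114 prices
(B≡) as an M-sized kernel station re-running the VALUES road ((U) values identity re-export, (E′), (Θ), (P) identity principle, (K), ≈ 250–400 l.).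
This sketch shows (B≡) needs NO values-level work at all: the identity principle was already spent, per class, INSIDE the landed
evaluation road — `StationR.Road.hERL_of_scaledColumnValues` (Theorems, the helper ONE LEVEL BELOW the registered station (R) text) already
returns the unit form `C ν · E = C u₀ · μ̃ · (L⁻ · u')`, `u'` a UNIT, `u₀` a CONSTANT; the registered (R) text merely forgets it
(`u ≠ 0`). Hence:

* §B **(R♯) PROVED** — `unitForm_valueRelation`: the registered (R) telescope VERBATIM with the conclusion strengthened to
  `∃ ν a U, ν ≠ 0 ∧ a ≠ 0 ∧ IsUnit U ∧ C ν · e(𝒸 z) = C a · 𝔯̃_e(c′) · μ̃ · (L⁻ · U)` (the landed proof of p725106 with the strong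
  socket in place of `_fixedMultiplier`; 4-line delta).
* §A **G1 PROVED** — cross-multiplying two unit-form relations along a commensurability `s₁ E₁ = s₂ E₂` and cancelling `L⁻`
  in the domain `Λ_𝒪`: `C(ν₂a₁)·𝔯̃₁·s₁·μ̃₁·U₁ = C(ν₁a₂)·𝔯̃₂·s₂·μ̃₂·U₂` — pure ring algebra.
* §C **(B≡) PROVED from unit forms** — `lam_add_eq_of_unitForms`: with the frame terms constants (`𝔯̃ᵢ = C bᵢ`, the coefficientwise
  gauge, §E) the landed λ-kit (`CharIdealLambda.finrank_baseChange_quotient_span_{C_mul_eq, mul_eq_add, smul_eq_add}`,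
  `ZetaQuotientComposite.isTorsion_quotient_of_smul_le`, `Ideal.span_singleton_mul_right_unit`) gives
  `λ(H/Λz) + λ(Λ/μ̃₂) = λ(H/Λz′) + λ(Λ/μ̃₁)`.
* §D **(K) PROVED** — commensurability of two non-zero classes from K0b's clauses (rank one, torsion-free) via the landed
  `S3BodyOfStations.isTorsion_quotient_span_of_rank_eq_one`; wrapper `lam_add_eq_of_unitForms_of_rank_eq_one`.
* §E **(E♯)-generic PROVED** — in the coefficientwise gauge of `PriceNode.exists_coeffwise_addEquiv`, `e (Pi.single i 1) = C (Φ⁻¹ δᵢ)`,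
  so every frame term `𝔯̃_e(c′) = Σ C(c′ᵢ) e(δᵢ)` is a constant.
* §F the ℕ-arithmetic of the consumer (child B at every class from child B at the witness + (B≡)).
* §A (÷) / §C `exists_ratioRelation_of_unitForms` **PROVED** — the RATIO RELATION `∃ a ≠ 0, t ≠ 0, C a·μ̃·s₁ = t·μ̃′·s₂` (the one
  hypothesis `hdvd` that Sketch_sidea_k1_g34.lean (T3)/(T4) leaves as «the ONE remaining analytic station, TYPED ONLY») from two unit forms —
  no (U), no (Θ), no (P), no `Module.Finite Λ_𝒪 𝐇¹`, no K0b.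
* §H **(E′) PROVED** — `exists_trivialisation_coeffwise`: station (E) GLOBAL (landed p722652's proof) with `e` kept in the coefficientwise gauge,
  i.e. the extra clause `∀ i, ∃ b, e (δᵢ) = C b` that T97 demands (row 114's second «S-sized re-export», here discharged).
v2 (this file) = v1 (crux-write 17:34Z, 10 decls, rc 0) + §A (÷), §C (÷)@Λ_𝒪, §H (E′). Skeleton of record when written: bt26_lambda v9
(2461eaa92ebb, 17:16:30Z; open leaves under `stub_cmLambdaLower` = cite-only `stub_printInputsRSLg` + the ∀-form `stub_kzgChildB`).

What stays for a prover (S/M, no analysis, no new station): the INSTANTIATION glue only — feed §B (R♯) twice (class `z`, witness `z₁`) with §H's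
`e`, then EITHER §C `lam_add_eq_of_unitForms` (+ §D under K0b's clauses) OR k1-g34's K0b-free consumer `childB_pair_of_witness_dvd` with
`hdvd :=` §C `exists_ratioRelation_of_unitForms`; the witness's (FIN₁) ∧ (LAM₁) is the PRINT node «Kato125AB» (typer lane, not here).

References: [cite: Kato2004Asterisque, Thm. 12.4 (2) (p. 221), Thm. 12.5 (1)–(2) (pp. 221–222), §13.8 (p. 228)] [cite: Pollack2003, Prop. 6.18]
[cite: Washington1997, §7.1, §13.2].
-/

set_option autoImplicit false
-- D-0017: single-problem summit, so `Summit.BirchSwinnertonDyer.BirchSwinnertonDyer.…` repeats a namespace BY DESIGN.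
set_option linter.dupNamespace false
set_option backward.isDefEq.respectTransparency false

noncomputable section

open scoped Classical NumberField Polynomial TensorProduct

open Polynomial (X C)
open NumberField IsDedekindDomain WeierstrassCurve Field Literature.NumberTheory.EllipticCurves
  Literature.NumberTheory.EllipticCurves.ModularForms
  Literature.NumberTheory.GaloisRepresentations Literature.NumberTheory.EllipticCurves.GreenbergSelmer
  Literature.NumberTheory.EllipticCurves.Rank1Residual Literature.NumberTheory.EllipticCurves.Kobayashi2003
  Literature.NumberTheory.EllipticCurves.FormalGroupChart Literature.NumberTheory.EllipticCurves.ZpExtension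
  Literature.NumberTheory.EllipticCurves.Sprung2012
  Summit.BirchSwinnertonDyer.Rank1Residual.Additive Summit.BirchSwinnertonDyer.Rank1Residual.Additive.PadicCyclotomicTower
  Summit.BirchSwinnertonDyer.BirchSwinnertonDyer.Theorems.ThetaTransport
  Rat.HeightOneSpectrum

/-! ## §A  G1 — the cross relation of two unit forms (generic ring algebra) -/

namespace Summit.BirchSwinnertonDyer.BirchSwinnertonDyer.Cruxes.ResidualThetaCountLowerPureAtTwo.SideaK3G30

section Algebra

variable {R : Type*} [CommRing R] [NoZeroDivisors R]

/-- **G1 (PROVED).** Two unit-form value relations `Cνᵢ · Eᵢ = Caᵢ · rᵢ · μᵢ · (L · Uᵢ)` whose columns are commensurable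
(`s₁ E₁ = s₂ E₂`) give, after cancelling `L ≠ 0`, ONE relation free of the columns and of `L`:
`Cν₂ Ca₁ r₁ s₁ μ₁ U₁ = Cν₁ Ca₂ r₂ s₂ μ₂ U₂`. [folklore] -/
theorem crossRelation_of_unitForms {Cν₁ Cν₂ Ca₁ Ca₂ r₁ r₂ μ₁ μ₂ L U₁ U₂ E₁ E₂ s₁ s₂ : R}
    (h₁ : Cν₁ * E₁ = Ca₁ * r₁ * μ₁ * (L * U₁)) (h₂ : Cν₂ * E₂ = Ca₂ * r₂ * μ₂ * (L * U₂))
    (hK : s₁ * E₁ = s₂ * E₂) (hL : L ≠ 0) :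
    Cν₂ * Ca₁ * r₁ * s₁ * μ₁ * U₁ = Cν₁ * Ca₂ * r₂ * s₂ * μ₂ * U₂ := by
  have e1 : Cν₂ * s₁ * (Cν₁ * E₁) = Cν₁ * s₂ * (Cν₂ * E₂) := by
    calc Cν₂ * s₁ * (Cν₁ * E₁) = Cν₁ * Cν₂ * (s₁ * E₁) := by ring
      _ = Cν₁ * Cν₂ * (s₂ * E₂) := by rw [hK]
      _ = Cν₁ * s₂ * (Cν₂ * E₂) := by ring
  rw [h₁, h₂] at e1
  have key : L * (Cν₂ * Ca₁ * r₁ * s₁ * μ₁ * U₁) = L * (Cν₁ * Ca₂ * r₂ * s₂ * μ₂ * U₂) := by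
    linear_combination e1
  exact mul_left_cancel₀ hL key

/-- **(÷) the RATIO RELATION from two unit forms (PROVED).** Dividing the cross relation by the unit `U₁`:
`Cν₂ Ca₁ r₁ · μ₁ · s₁ = (Cν₁ Ca₂ r₂ · U₂ · U₁⁻¹) · μ₂ · s₂` — the shape of k1-g34's one remaining hypothesis `hdvd`
(`C a · μ̃ · s₁ = t · μ̃₁ · s₂`), here with `t` a constant times a unit. [folklore] -/
theorem ratioRelation_of_unitForms {Cν₁ Cν₂ Ca₁ Ca₂ r₁ r₂ μ₁ μ₂ L U₁ U₂ E₁ E₂ s₁ s₂ : R}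
    (h₁ : Cν₁ * E₁ = Ca₁ * r₁ * μ₁ * (L * U₁)) (h₂ : Cν₂ * E₂ = Ca₂ * r₂ * μ₂ * (L * U₂))
    (hK : s₁ * E₁ = s₂ * E₂) (hL : L ≠ 0) (hU₁ : IsUnit U₁) :
    Cν₂ * Ca₁ * r₁ * μ₁ * s₁ = (Cν₁ * Ca₂ * r₂ * U₂ * ↑(hU₁.unit⁻¹)) * μ₂ * s₂ := by
  have hX := crossRelation_of_unitForms h₁ h₂ hK hL
  have hinv : U₁ * ↑(hU₁.unit⁻¹) = 1 := hU₁.mul_val_inv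
  linear_combination (↑(hU₁.unit⁻¹) : R) * hX - (Cν₂ * Ca₁ * r₁ * μ₁ * s₁) * hinv

end Algebra

/-! ## §E  (E♯)-generic — frame terms are constants in the coefficientwise gauge -/

section Coeffwise

variable {R : Type*} [CommRing R] {𝒪 : Type*} [CommRing 𝒪] {n : ℕ}

/-- **(E♯)-generic (PROVED).** For the coefficientwise trivialisation `e` of `PriceNode.exists_coeffwise_addEquiv Φ`
(`(e t)_m = Φ⁻¹ ((t i)_m)_i`), the basis columns are CONSTANTS: `e (δᵢ) = C (Φ⁻¹ δᵢ)`. [cite: Washington1997, §7.1] -/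
theorem single_eq_C_of_coeffwise (Φ : 𝒪 ≃+ (Fin n → R)) (e : (Fin n → PowerSeries R) ≃+ PowerSeries 𝒪)
    (he : ∀ (t : Fin n → PowerSeries R) (m : ℕ), PowerSeries.coeff m (e t) = Φ.symm fun i => PowerSeries.coeff m (t i))
    (i : Fin n) : e (Pi.single i 1) = PowerSeries.C (Φ.symm (Pi.single i 1)) := by
  ext m
  rw [he, PowerSeries.coeff_C]
  by_cases hm : m = 0
  · subst hm
    rw [if_pos rfl]
    congr 1
    funext j
    by_cases hj : j = i
    · subst hj; simp
    · simp [hj]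
  · rw [if_neg hm]
    have h0 : (fun j => PowerSeries.coeff m ((Pi.single i (1 : PowerSeries R) : Fin n → PowerSeries R) j)) = 0 := by
      funext j
      by_cases hj : j = i
      · subst hj; simp [PowerSeries.coeff_one, hm]
      · simp [hj]
    rw [h0, map_zero]

/-- **Frame terms are constants (PROVED).** `𝔯̃_e(c′) = Σᵢ C(c′ᵢ) · e(δᵢ) = C (Σᵢ c′ᵢ · Φ⁻¹ δᵢ)` in the coefficientwise gauge. -/
theorem frameTerm_eq_C_of_coeffwise (Φ : 𝒪 ≃+ (Fin n → R)) (e : (Fin n → PowerSeries R) ≃+ PowerSeries 𝒪)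
    (he : ∀ (t : Fin n → PowerSeries R) (m : ℕ), PowerSeries.coeff m (e t) = Φ.symm fun i => PowerSeries.coeff m (t i))
    (c' : Fin n → 𝒪) :
    ∑ i, PowerSeries.C (c' i) * e (Pi.single i 1) = PowerSeries.C (∑ i, c' i * Φ.symm (Pi.single i 1)) := by
  rw [map_sum]
  refine Finset.sum_congr rfl fun i _ => ?_
  rw [single_eq_C_of_coeffwise Φ e he i, ← map_mul]

end Coeffwise

/-! ## §D  (K) — commensurability from K0b's clauses (rank one, torsion-free) -/

section Commensurable

variable {Λ : Type*} [CommRing Λ] [IsDomain Λ] {H : Type*} [AddCommGroup H] [Module Λ H]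

/-- **(K) (PROVED).** In a torsion-free `Λ`-module of rank one (Kato 12.4 (2) = K0b's clauses), two non-zero classes are
commensurable with NON-ZERO multipliers: `s₁ • z = s₂ • z′`. [cite: Kato2004Asterisque, Thm. 12.4 (2) (p. 221)] -/
theorem exists_smul_eq_smul_of_rank_eq_one (hrk : Module.rank Λ H = 1)
    (htf : ∀ (a : Λ) (x : H), a • x = 0 → a = 0 ∨ x = 0) {z z' : H} (hz : z ≠ 0) (hz' : z' ≠ 0) :
    ∃ s₁ s₂ : Λ, s₁ ≠ 0 ∧ s₂ ≠ 0 ∧ s₁ • z = s₂ • z' := by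
  have hzf' : ∀ a : Λ, a • z' = 0 → a = 0 := fun a ha => (htf a z' ha).resolve_right hz'
  have htors := Theorems.ThetaTransport.S3BodyOfStations.isTorsion_quotient_span_of_rank_eq_one hrk z' hzf'
  obtain ⟨⟨s₁, hs₁⟩, hs⟩ := @htors (Submodule.Quotient.mk z)
  have hs₁0 : s₁ ≠ 0 := nonZeroDivisors.ne_zero hs₁
  have hmem : s₁ • z ∈ Submodule.span Λ ({z'} : Set H) := by
    rw [← Submodule.Quotient.mk_eq_zero, Submodule.Quotient.mk_smul]
    exact hs
  obtain ⟨s₂, hs₂⟩ := Submodule.mem_span_singleton.mp hmem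
  refine ⟨s₁, s₂, hs₁0, ?_, hs₂.symm⟩
  rintro rfl
  rw [zero_smul] at hs₂
  rcases htf s₁ z hs₂.symm with h | h
  · exact hs₁0 h
  · exact hz h

end Commensurable

/-! ## §C  (B≡) from two unit forms — the λ-bookkeeping over `Λ_𝒪` (landed kit only) -/

section SlackInvariance

open Summit.BirchSwinnertonDyer.BirchSwinnertonDyer.Theorems Summit.BirchSwinnertonDyer.BirchSwinnertonDyer.Theorems.OnePair

variable {S : Set (PadicAlgCl 2)}
  [IsDiscreteValuationRing (coeffO S)] [IsAdicComplete (IsLocalRing.maximalIdeal (coeffO S)) (coeffO S)]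
  {H : Type} [AddCommGroup H] [Module (IwasawaAlgebraO S) H] [Module (coeffO S) H]
  [IsScalarTower (coeffO S) (IwasawaAlgebraO S) H] [Module.Finite (IwasawaAlgebraO S) H]

omit [IsDiscreteValuationRing (coeffO S)]
  [IsAdicComplete (IsLocalRing.maximalIdeal (coeffO S)) (coeffO S)] [Module (coeffO S) H]
  [IsScalarTower (coeffO S) (IwasawaAlgebraO S) H] [Module.Finite (IwasawaAlgebraO S) H] in
/-- A class whose (semilinear) column is non-zero is torsion-free (= landed `S3BodyOfStations.torsionFree_of_column`, functional form). -/
theorem torsionFree_of_unitForm (E : H → IwasawaAlgebraO S) (hE : ∀ (s : IwasawaAlgebraO S) (x : H), E (s • x) = s * E x)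
    {z : H} (hEz : E z ≠ 0) (a : IwasawaAlgebraO S) (ha : a • z = 0) : a = 0 :=
  ThetaTransport.S3BodyOfStations.torsionFree_of_column E z (E z) hEz (fun r => hE r z) a ha

omit [IsDiscreteValuationRing (coeffO S)]
  [IsAdicComplete (IsLocalRing.maximalIdeal (coeffO S)) (coeffO S)] [Module (coeffO S) H]
  [IsScalarTower (coeffO S) (IwasawaAlgebraO S) H] [Module.Finite (IwasawaAlgebraO S) H] in
/-- **(÷) at the pins' currency (PROVED) = k1-g34's hypothesis `hdvd` DISCHARGED.** Two classes `z` (any valued class) and `z′` (the witness)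
with unit-form value relations through ONE `Λ_𝒪`-semilinear column `E = e ∘ 𝒸` whose frame terms are constants (`C bᵢ`, coefficientwise gauge §E/§H),
and a commensurability `s₁ • z = s₂ • z′`: THEN `∃ a ≠ 0, t ≠ 0, C a · μ̃ · s₁ = t · μ̃′ · s₂` — exactly the input of
`SideaK1G34.childB_pair_of_witness_dvd` / `slack_le_of_dvd_ratio` (Sketch_sidea_k1_g34.lean §2 (T3)), with NO analytic station ((U), (Θ), (P) of
k1-g31 PLAN 1 are not needed: the identity principle was spent inside the landed road `StationR.Road.hERL_of_scaledColumnValues`, §B).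
No `Module.Finite Λ_𝒪 𝐇¹`, no K0b. [cite: Kato2004Asterisque, Thm. 12.5 (1)–(2) (pp. 221–222)] -/
theorem exists_ratioRelation_of_unitForms (E : H → IwasawaAlgebraO S) (hE : ∀ (s : IwasawaAlgebraO S) (x : H), E (s • x) = s * E x)
    {z z' : H} {s₁ s₂ : IwasawaAlgebraO S} (hK : s₁ • z = s₂ • z')
    {ν₁ ν₂ a₁ a₂ b₁ b₂ : coeffO S} (hν₁ : ν₁ ≠ 0) (hν₂ : ν₂ ≠ 0) (ha₁ : a₁ ≠ 0) (ha₂ : a₂ ≠ 0) (hb₁ : b₁ ≠ 0) (hb₂ : b₂ ≠ 0)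
    {μ₁ μ₂ Lm U₁ U₂ : IwasawaAlgebraO S} (hLm : Lm ≠ 0) (hU₁ : IsUnit U₁) (hU₂ : IsUnit U₂)
    (h₁ : PowerSeries.C ν₁ * E z = PowerSeries.C a₁ * PowerSeries.C b₁ * μ₁ * (Lm * U₁))
    (h₂ : PowerSeries.C ν₂ * E z' = PowerSeries.C a₂ * PowerSeries.C b₂ * μ₂ * (Lm * U₂)) :
    ∃ (a : coeffO S) (t : IwasawaAlgebraO S), a ≠ 0 ∧ t ≠ 0 ∧ PowerSeries.C a * μ₁ * s₁ = t * μ₂ * s₂ := by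
  have hCne : ∀ {c : coeffO S}, c ≠ 0 → (PowerSeries.C c : IwasawaAlgebraO S) ≠ 0 := fun {c} hc h => by
    apply hc
    have h1 := congr_arg (PowerSeries.coeff 0) h
    rwa [PowerSeries.coeff_zero_C, map_zero] at h1
  have hKE : s₁ * E z = s₂ * E z' := by rw [← hE, ← hE, hK]
  have hX := ratioRelation_of_unitForms h₁ h₂ hKE hLm hU₁
  refine ⟨ν₂ * a₁ * b₁, PowerSeries.C ν₁ * PowerSeries.C a₂ * PowerSeries.C b₂ * U₂ * ↑(hU₁.unit⁻¹),
    mul_ne_zero (mul_ne_zero hν₂ ha₁) hb₁, ?_, ?_⟩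
  · exact mul_ne_zero (mul_ne_zero (mul_ne_zero (mul_ne_zero (hCne hν₁) (hCne ha₂)) (hCne hb₂)) hU₂.ne_zero)
      (hU₁.unit⁻¹).isUnit.ne_zero
  · rw [map_mul, map_mul]
    exact hX

/-- **(B≡) from unit forms (PROVED).** `H` a finitely generated `Λ_𝒪`-module (K0b (12.2.1)), `E : H → Λ_𝒪` `Λ_𝒪`-semilinear
(station (E), GLOBAL form: `OnePairPins.exists_trivialisation`), two classes `z, z′` commensurable (`s₁ • z = s₂ • z′`, `sᵢ ≠ 0`,
§D) with `H/Λz` torsion, each carrying a UNIT-FORM value relation `C νᵢ · E zᵢ = C aᵢ · C bᵢ · μ̃ᵢ · (L⁻ · Uᵢ)` (§B (R♯) in the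
coefficientwise gauge §E: the frame term `𝔯̃ = C bᵢ`). THEN `λ(H/Λz) + λ(Λ/μ̃₂) = λ(H/Λz′) + λ(Λ/μ̃₁)` — the slack
`λ(H/Λz) − λ(Λ/μ̃)` is CLASS-INVARIANT. No identity principle, no values, no Rohrlich input: ring algebra (§A) + the landed λ-kit.
[cite: Kato2004Asterisque, Thm. 12.5 (1)–(2) (pp. 221–222), §13.8 (p. 228)] -/
theorem lam_add_eq_of_unitForms (E : H → IwasawaAlgebraO S) (hE : ∀ (s : IwasawaAlgebraO S) (x : H), E (s • x) = s * E x)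
    {z z' : H} (htors : Module.IsTorsion (IwasawaAlgebraO S) (H ⧸ Submodule.span (IwasawaAlgebraO S) ({z} : Set H)))
    {s₁ s₂ : IwasawaAlgebraO S} (hs₁ : s₁ ≠ 0) (hs₂ : s₂ ≠ 0) (hK : s₁ • z = s₂ • z')
    {ν₁ ν₂ a₁ a₂ b₁ b₂ : coeffO S} (hν₁ : ν₁ ≠ 0) (hν₂ : ν₂ ≠ 0) (ha₁ : a₁ ≠ 0) (ha₂ : a₂ ≠ 0) (hb₁ : b₁ ≠ 0) (hb₂ : b₂ ≠ 0)
    {μ₁ μ₂ Lm U₁ U₂ : IwasawaAlgebraO S} (hμ₁ : μ₁ ≠ 0) (hμ₂ : μ₂ ≠ 0) (hLm : Lm ≠ 0) (hU₁ : IsUnit U₁) (hU₂ : IsUnit U₂)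
    (h₁ : PowerSeries.C ν₁ * E z = PowerSeries.C a₁ * PowerSeries.C b₁ * μ₁ * (Lm * U₁))
    (h₂ : PowerSeries.C ν₂ * E z' = PowerSeries.C a₂ * PowerSeries.C b₂ * μ₂ * (Lm * U₂)) :
    lamO S (H ⧸ Submodule.span (IwasawaAlgebraO S) ({z} : Set H)) + lamO S (IwasawaAlgebraO S ⧸ Ideal.span {μ₂}) =
      lamO S (H ⧸ Submodule.span (IwasawaAlgebraO S) ({z'} : Set H)) + lamO S (IwasawaAlgebraO S ⧸ Ideal.span {μ₁}) := by
  -- the columns are non-zero, hence both classes are torsion-free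
  have hCne : ∀ {c : coeffO S}, c ≠ 0 → (PowerSeries.C c : IwasawaAlgebraO S) ≠ 0 := fun {c} hc h => by
    apply hc
    have h1 := congr_arg (PowerSeries.coeff 0) h
    rwa [PowerSeries.coeff_zero_C, map_zero] at h1
  have hEz : E z ≠ 0 := fun h0 => by
    have : PowerSeries.C a₁ * PowerSeries.C b₁ * μ₁ * (Lm * U₁) = 0 := by rw [← h₁, h0, mul_zero]
    exact mul_ne_zero (mul_ne_zero (mul_ne_zero (hCne ha₁) (hCne hb₁)) hμ₁) (mul_ne_zero hLm hU₁.ne_zero) this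
  have hEz' : E z' ≠ 0 := fun h0 => by
    have : PowerSeries.C a₂ * PowerSeries.C b₂ * μ₂ * (Lm * U₂) = 0 := by rw [← h₂, h0, mul_zero]
    exact mul_ne_zero (mul_ne_zero (mul_ne_zero (hCne ha₂) (hCne hb₂)) hμ₂) (mul_ne_zero hLm hU₂.ne_zero) this
  have hz : ∀ a : IwasawaAlgebraO S, a • z = 0 → a = 0 := torsionFree_of_unitForm E hE hEz
  have hz' : ∀ a : IwasawaAlgebraO S, a • z' = 0 → a = 0 := torsionFree_of_unitForm E hE hEz'
  -- (1) the cross relation (§A): `C(ν₂ a₁ b₁) · (s₁ μ₁) · U₁ = C(ν₁ a₂ b₂) · (s₂ μ₂) · U₂`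
  have hKE : s₁ * E z = s₂ * E z' := by rw [← hE, ← hE, hK]
  have hX := crossRelation_of_unitForms h₁ h₂ hKE hLm
  have hrel : PowerSeries.C (ν₂ * a₁ * b₁) * (s₁ * μ₁) * U₁ = PowerSeries.C (ν₁ * a₂ * b₂) * (s₂ * μ₂) * U₂ := by
    rw [map_mul, map_mul, map_mul, map_mul]
    linear_combination hX
  have hc₁ : ν₂ * a₁ * b₁ ≠ 0 := mul_ne_zero (mul_ne_zero hν₂ ha₁) hb₁
  have hc₂ : ν₁ * a₂ * b₂ ≠ 0 := mul_ne_zero (mul_ne_zero hν₁ ha₂) hb₂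
  -- (2) λ of both sides: units and constants are invisible, products add
  have eU₁ : Ideal.span {PowerSeries.C (ν₂ * a₁ * b₁) * (s₁ * μ₁) * U₁} = Ideal.span {PowerSeries.C (ν₂ * a₁ * b₁) * (s₁ * μ₁)} :=
    Ideal.span_singleton_mul_right_unit hU₁ _
  have eU₂ : Ideal.span {PowerSeries.C (ν₁ * a₂ * b₂) * (s₂ * μ₂) * U₂} = Ideal.span {PowerSeries.C (ν₁ * a₂ * b₂) * (s₂ * μ₂)} :=
    Ideal.span_singleton_mul_right_unit hU₂ _
  have key : lamO S (IwasawaAlgebraO S ⧸ Ideal.span {PowerSeries.C (ν₂ * a₁ * b₁) * (s₁ * μ₁) * U₁}) =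
      lamO S (IwasawaAlgebraO S ⧸ Ideal.span {PowerSeries.C (ν₁ * a₂ * b₂) * (s₂ * μ₂) * U₂}) := by rw [hrel]
  rw [eU₁, eU₂] at key
  have eC₁ : lamO S (IwasawaAlgebraO S ⧸ Ideal.span {PowerSeries.C (ν₂ * a₁ * b₁) * (s₁ * μ₁)}) =
      lamO S (IwasawaAlgebraO S ⧸ Ideal.span {s₁ * μ₁}) :=
    CharIdealLambda.finrank_baseChange_quotient_span_C_mul_eq (FractionRing (coeffO S)) hc₁ (mul_ne_zero hs₁ hμ₁)
  have eC₂ : lamO S (IwasawaAlgebraO S ⧸ Ideal.span {PowerSeries.C (ν₁ * a₂ * b₂) * (s₂ * μ₂)}) =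
      lamO S (IwasawaAlgebraO S ⧸ Ideal.span {s₂ * μ₂}) :=
    CharIdealLambda.finrank_baseChange_quotient_span_C_mul_eq (FractionRing (coeffO S)) hc₂ (mul_ne_zero hs₂ hμ₂)
  have eM₁ : lamO S (IwasawaAlgebraO S ⧸ Ideal.span {s₁ * μ₁}) =
      lamO S (IwasawaAlgebraO S ⧸ Ideal.span {μ₁}) + lamO S (IwasawaAlgebraO S ⧸ Ideal.span {s₁}) :=
    CharIdealLambda.finrank_baseChange_quotient_span_mul_eq_add (FractionRing (coeffO S)) hs₁ hμ₁
  have eM₂ : lamO S (IwasawaAlgebraO S ⧸ Ideal.span {s₂ * μ₂}) =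
      lamO S (IwasawaAlgebraO S ⧸ Ideal.span {μ₂}) + lamO S (IwasawaAlgebraO S ⧸ Ideal.span {s₂}) :=
    CharIdealLambda.finrank_baseChange_quotient_span_mul_eq_add (FractionRing (coeffO S)) hs₂ hμ₂
  -- (3) the `H`-side: `λ(H/Λ s₁z) = λ(H/Λz) + λ(Λ/s₁)`, `λ(H/Λ s₂z′) = λ(H/Λz′) + λ(Λ/s₂)`, and `s₁ z = s₂ z′`
  have htors' : Module.IsTorsion (IwasawaAlgebraO S) (H ⧸ Submodule.span (IwasawaAlgebraO S) ({z'} : Set H)) := by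
    refine CharIdealLambda.ZetaQuotientComposite.isTorsion_quotient_of_smul_le s₁ hs₁ (fun w hw => ?_) htors
    obtain ⟨r, rfl⟩ := Submodule.mem_span_singleton.mp hw
    rw [smul_smul, mul_comm, ← smul_smul, hK, smul_smul]
    exact Submodule.mem_span_singleton.mpr ⟨r * s₂, rfl⟩
  have f₁ : lamO S (H ⧸ Submodule.span (IwasawaAlgebraO S) ({s₁ • z} : Set H)) =
      lamO S (H ⧸ Submodule.span (IwasawaAlgebraO S) ({z} : Set H)) + lamO S (IwasawaAlgebraO S ⧸ Ideal.span {s₁}) :=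
    CharIdealLambda.finrank_baseChange_quotient_span_smul_eq_add (FractionRing (coeffO S)) z hz s₁ hs₁ htors
  have f₂ : lamO S (H ⧸ Submodule.span (IwasawaAlgebraO S) ({s₂ • z'} : Set H)) =
      lamO S (H ⧸ Submodule.span (IwasawaAlgebraO S) ({z'} : Set H)) + lamO S (IwasawaAlgebraO S ⧸ Ideal.span {s₂}) :=
    CharIdealLambda.finrank_baseChange_quotient_span_smul_eq_add (FractionRing (coeffO S)) z' hz' s₂ hs₂ htors'
  have f₁₂ : lamO S (H ⧸ Submodule.span (IwasawaAlgebraO S) ({s₁ • z} : Set H)) =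
      lamO S (H ⧸ Submodule.span (IwasawaAlgebraO S) ({s₂ • z'} : Set H)) := by rw [hK]
  -- (4) bookkeeping in ℕ
  omega

/-- **Finiteness of `Frac 𝒪 ⊗ H/Λz` for EVERY torsion-free class under rank one (PROVED)** — child B's (ii_fin) conjunct is free
at every class once K0b (finite generation, rank one) is in the print stub. [cite: Kato2004Asterisque, Thm. 12.4 (2) (p. 221)] -/
theorem finite_baseChange_zetaQuot_of_rank_eq_one (hrk : Module.rank (IwasawaAlgebraO S) H = 1)
    {z : H} (hz : ∀ a : IwasawaAlgebraO S, a • z = 0 → a = 0) :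
    Module.Finite (FractionRing (coeffO S))
      (TensorProduct (coeffO S) (FractionRing (coeffO S)) (H ⧸ Submodule.span (IwasawaAlgebraO S) ({z} : Set H))) :=
  CharIdealLambda.finite_baseChange_of_isTorsion (FractionRing (coeffO S)) (H ⧸ Submodule.span (IwasawaAlgebraO S) ({z} : Set H))
    (ThetaTransport.S3BodyOfStations.isTorsion_quotient_span_of_rank_eq_one hrk z hz)

/-- **(B≡) under K0b's clauses (PROVED wrapper = §D + §C).** Rank one + torsion-free + two unit-form relations (frame terms
constant) ⟹ the slack identity, with the commensurability produced internally. [cite: Kato2004Asterisque, Thm. 12.4 (2), Thm. 12.5 (1)–(2)] -/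
theorem lam_add_eq_of_unitForms_of_rank_eq_one (hrk : Module.rank (IwasawaAlgebraO S) H = 1)
    (htf : ∀ (a : IwasawaAlgebraO S) (x : H), a • x = 0 → a = 0 ∨ x = 0)
    (E : H → IwasawaAlgebraO S) (hE : ∀ (s : IwasawaAlgebraO S) (x : H), E (s • x) = s * E x) {z z' : H}
    {ν₁ ν₂ a₁ a₂ b₁ b₂ : coeffO S} (hν₁ : ν₁ ≠ 0) (hν₂ : ν₂ ≠ 0) (ha₁ : a₁ ≠ 0) (ha₂ : a₂ ≠ 0) (hb₁ : b₁ ≠ 0) (hb₂ : b₂ ≠ 0)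
    {μ₁ μ₂ Lm U₁ U₂ : IwasawaAlgebraO S} (hμ₁ : μ₁ ≠ 0) (hμ₂ : μ₂ ≠ 0) (hLm : Lm ≠ 0) (hU₁ : IsUnit U₁) (hU₂ : IsUnit U₂)
    (h₁ : PowerSeries.C ν₁ * E z = PowerSeries.C a₁ * PowerSeries.C b₁ * μ₁ * (Lm * U₁))
    (h₂ : PowerSeries.C ν₂ * E z' = PowerSeries.C a₂ * PowerSeries.C b₂ * μ₂ * (Lm * U₂)) :
    lamO S (H ⧸ Submodule.span (IwasawaAlgebraO S) ({z} : Set H)) + lamO S (IwasawaAlgebraO S ⧸ Ideal.span {μ₂}) =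
      lamO S (H ⧸ Submodule.span (IwasawaAlgebraO S) ({z'} : Set H)) + lamO S (IwasawaAlgebraO S ⧸ Ideal.span {μ₁}) := by
  have hE0 : E 0 = 0 := by simpa using hE 0 0
  have hCne : ∀ {c : coeffO S}, c ≠ 0 → (PowerSeries.C c : IwasawaAlgebraO S) ≠ 0 := fun {c} hc h => by
    apply hc
    have h1 := congr_arg (PowerSeries.coeff 0) h
    rwa [PowerSeries.coeff_zero_C, map_zero] at h1
  have hz0 : z ≠ 0 := by
    rintro rfl
    have : PowerSeries.C a₁ * PowerSeries.C b₁ * μ₁ * (Lm * U₁) = 0 := by rw [← h₁, hE0, mul_zero]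
    exact mul_ne_zero (mul_ne_zero (mul_ne_zero (hCne ha₁) (hCne hb₁)) hμ₁) (mul_ne_zero hLm hU₁.ne_zero) this
  have hz0' : z' ≠ 0 := by
    rintro rfl
    have : PowerSeries.C a₂ * PowerSeries.C b₂ * μ₂ * (Lm * U₂) = 0 := by rw [← h₂, hE0, mul_zero]
    exact mul_ne_zero (mul_ne_zero (mul_ne_zero (hCne ha₂) (hCne hb₂)) hμ₂) (mul_ne_zero hLm hU₂.ne_zero) this
  obtain ⟨s₁, s₂, hs₁, hs₂, hK⟩ := exists_smul_eq_smul_of_rank_eq_one hrk htf hz0 hz0'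
  have hz : ∀ a : IwasawaAlgebraO S, a • z = 0 → a = 0 := fun a ha => (htf a z ha).resolve_right hz0
  exact lam_add_eq_of_unitForms E hE (ThetaTransport.S3BodyOfStations.isTorsion_quotient_span_of_rank_eq_one hrk z hz)
    hs₁ hs₂ hK hν₁ hν₂ ha₁ ha₂ hb₁ hb₂ hμ₁ hμ₂ hLm hU₁ hU₂ h₁ h₂

end SlackInvariance

/-! ## §F  The consumer's arithmetic -/

/-- **Child B at every class from child B at the witness + (B≡)** (the ℕ-bookkeeping; (ii_fin) is
`finite_baseChange_zetaQuot_of_rank_eq_one`). `hz = λ(H/Λz)`, `m = λ(Λ/μ̃)` of the class; primed = the witness. -/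
theorem childB_transfer {hz m hz' m' sel : ℕ} (hw : hz' ≤ sel + m') (hslack : hz + m' = hz' + m) : hz ≤ sel + m := by
  omega

end Summit.BirchSwinnertonDyer.BirchSwinnertonDyer.Cruxes.ResidualThetaCountLowerPureAtTwo.SideaK3G30

/-! ## §B  (R♯) — the UNIT-FORM station (R), PROVED (landed p725106 proof, strong socket `hERL_of_scaledColumnValues`) -/

namespace Summit.BirchSwinnertonDyer.BirchSwinnertonDyer.Theorems.OnePair.SideaK3G30

set_option maxHeartbeats 3200000 in
/-- **(R♯) `unitForm_valueRelation` (PROVED).** The registered station (R) telescope of `stub_kzgValueRelation` VERBATIM, conclusion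
STRENGTHENED to the unit form `∃ ν a U, ν ≠ 0 ∧ a ≠ 0 ∧ IsUnit U ∧ C ν · e(𝒸 z) = C a · 𝔯̃_e(c′) · μ̃ · (L⁻ · U)` with
`𝔯̃_e(c′) = Σ C(c′ᵢ) e(δᵢ)`: the landed proof with `StationR.Road.hERL_of_scaledColumnValues` (which returns `u₀`, `IsUnit u'`) in
place of `…_fixedMultiplier` (which forgets them). [cite: Kato2004Asterisque, Thm. 12.5 (1) (pp. 221–222), §15.16 (p. 265)]
[cite: Kobayashi2003, Thm. 6.2, (8.23) (p. 18), Prop. 8.25–8.26] [cite: Pollack2003, Prop. 6.18] [cite: Lang2002, Ch. VI §4 Thm. 4.1] -/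
theorem unitForm_valueRelation :
    open Literature.NumberTheory.EllipticCurves GreenbergSelmer GreenbergVatsal2000 Kobayashi2003 ModularForms Rank1Residual Literature.NumberTheory.GaloisRepresentations Literature.NumberTheory.Automorphic IsDedekindDomain NumberField Field Rat.HeightOneSpectrum PowerSeries Summit.BirchSwinnertonDyer.BirchSwinnertonDyer.Theorems.OnePair in ∀ (W : WeierstrassCurve ℚ) [W.IsElliptic] [W.IsGloballyMinimal], ¬ W.HasCM → W.analyticRank = 0 → GoodSS W 2 → W.frobeniusTrace 2 = 0 → W.Δ < 0 → ∀ (M : ℕ) [NeZero M] (g : CuspForm (CongruenceSubgroup.Gamma0 M) 2) (ι : coeffField g →+* PadicAlgCl 2) (Ω : ℂ), Odd M → IsNewform0 g → IsCMForm (liftToGamma1 M 2 g) → cuspCoeff g 2 = 0 → IsCohomologicalPlusPeriod g ι Ω → (∀ ℓ : ℕ, ℓ.Prime → ¬ ℓ ∣ 2 * M * W.conductorNorm ℤ → ‖embCoeff g ι ℓ - (W.frobeniusTrace ℓ : PadicAlgCl 2)‖ < 1) → ∀ (κ : ZpExtension ℚ 2) (γ : absoluteGaloisGroup ℚ), κ.IsCyclotomic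 → κ.IsTopGenerator γ → IsCyclotomicVariable 2 γ → ∀ (S₀ : Finset (HeightOneSpectrum (RingOfIntegers ℚ))), (∀ v ∈ S₀, ((2 : ℕ) : RingOfIntegers ℚ) ∉ v.asIdeal) → (∀ v, ¬ W.HasGoodReductionAt v → v ∈ S₀) → (∀ v, natGenerator v ∣ M → v ∈ S₀) → ∀ (Lp Lm : IwasawaAlgebraO (Set.range ι)) (d : ℕ), IsPollackPairK g ι Ω Lp Lm → (∀ k, ‖coeff k (iwasawaOToPowerSeries (Set.range ι) Lm)‖ ≤ ‖coeff d (iwasawaOToPowerSeries (Set.range ι) Lm)‖) → (∀ k < d, ‖coeff k (iwasawaOToPowerSeries (Set.range ι) Lm)‖ < ‖coeff d (iwasawaOToPowerSeries (Set.range ι) Lm)‖) → ∀ (n : ℕ) (ρ : FramedGaloisRep ℚ (coeffO (Set.range ι)) 2) (Θ : ∀ v : HeightOneSpectrum (RingOfIntegers ℚ), ((2 : ℕ) : RingOfIntegers ℚ) ∈ v.asIdeal → (CofreeF (Set.range ι) ρ ≃+ (Fin n → ↥(W.geomPrimaryTorsion 2)))), (∀ v, ¬ natGenerator v ∣ 2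 * M → ρ.IsUnramifiedAt v ∧ ∃ P : Polynomial (coeffO (Set.range ι)), P.map (padicCoeffIntegers (Set.range ι)).subtype = Polynomial.X ^ 2 - Polynomial.C (embCoeff g ι (natGenerator v)) * Polynomial.X + Polynomial.C ((natGenerator v : ℕ) : PadicAlgCl 2) ∧ ρ.HasFrobCharpolyAt v P) → ∀ (hΘ : ∀ v hv (δ : absoluteGaloisGroup (v.adicCompletion ℚ)) m i, Θ v hv (resGalOfEmb (closureEmb (K := ℚ) (v.adicCompletion ℚ)) δ • m) i = resGalOfEmb (closureEmb (K := ℚ) (v.adicCompletion ℚ)) δ • Θ v hv m i), ∀ (ϖ : (coeffO (Set.range ι))), Irreducible ϖ → ∀ (Sg : AddSubgroup (H1Γ (Set.range ι) κ ρ)) [Module (coeffO (Set.range ι)) ↥Sg], (∀ (a : (coeffO (Set.range ι))) (s : ↥Sg), ((a • s : ↥Sg) : H1Γ (Set.range ι) κ ρ) = scalarH1 κ.kerSubgroup (CofreeF (Set.range ι) ρ) a s) → (∀ y : H1Γ (Set.range ι) κ ρ, y ∈ Sg ↔ y ∈ plusSelmerSet (Set.range ι) W κ S₀ n ρ Θ)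 → (∀ (τ : absoluteGaloisGroup ℚ) (y : H1Γ (Set.range ι) κ ρ), y ∈ Sg → conjH1 κ.kerSubgroup (CofreeF (Set.range ι) ρ) τ y ∈ Sg) → (plusSelmerTorsionSet (Set.range ι) W κ S₀ n ρ Θ ϖ).Finite → ∀ (I : Kato2004.IwasawaH1DataCoeff (FramedGaloisRep.toGaloisRep ρ) 2 κ γ) [Module (coeffO (Set.range ι)) I.H] [IsScalarTower (coeffO (Set.range ι)) (IwasawaAlgebraO (Set.range ι)) I.H], (∀ (a : (coeffO (Set.range ι))) (x : I.H), a • x = (PowerSeries.C a : IwasawaAlgebraO (Set.range ι)) • x) → ∀ (π : OnePairPins (Set.range ι) W κ γ S₀ n ρ Θ hΘ I Sg), ∀ (F : π.KatoFrame) (z : I.H) (c' : Fin n → coeffO (Set.range ι)) (w : ℕ → Fin π.nb → PadicAlgCl 2) (q : PadicAlgCl 2) (μt : IwasawaAlgebraO (Set.range ι)), π.KatoValuedClass g ι Ω F.Φ F.τ z c' w q μt → ∀ (e : (Fin n → PowerSeries ℤ_[2]) ≃+ IwasawaAlgebraO (Set.range ι)), (∀ (r : PowerSeries ℤ_[2])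 (t : Fin n → PowerSeries ℤ_[2]), e (r • t) = PowerSeries.map (padicIntToCoeffIntegers (Set.range ι)) r * e t) → (∀ (s : IwasawaAlgebraO (Set.range ι)) (x : I.H), x ∈ Submodule.span (IwasawaAlgebraO (Set.range ι)) ({z} : Set I.H) → e (π.cvec (s • x)) = s * e (π.cvec x)) → ∃ (ν a : coeffO (Set.range ι)) (U : IwasawaAlgebraO (Set.range ι)), ν ≠ 0 ∧ a ≠ 0 ∧ IsUnit U ∧ PowerSeries.C ν * e (π.cvec z) = PowerSeries.C a * (∑ i : Fin n, PowerSeries.C (c' i) * e (Pi.single i 1)) * μt * (Lm * U) := by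
  intro W _ _ hcm hr hss ha hΔ M _ g ι Ω hM hg hcmg ha2 hΩ hcong κ γ hκ hγ hcv S₀ hS₀2 hS₀bad hS₀M Lp Lm dd hPP hlam1 hlam2 n ρ Θ hfrob hΘ ϖ hϖ
    Sg _ hSg1 hSg2 hSg3 hfin I _ _ hIC π F z c' w q μt hA e he hlin
  obtain ⟨hq0, hμ0, hND, hBK, hVAL, -⟩ := hA
  haveI : FiniteDimensional ℚ (ModularForms.coeffField g) := ModularForms.IsNewform0.finiteDimensional_coeffField_holds hg
  haveI : FiniteDimensional ℚ_[2] ↥(padicCoeffField (Set.range ι)) := GreenbergSelmer.finiteDimensional_padicCoeffField ι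
  have hlin' : ∀ y : ↥(padicCoeffIntegers (Set.range ι)),
      e (π.cvec ((PowerSeries.C y : IwasawaAlgebraO (Set.range ι)) • z)) = PowerSeries.C y * e (π.cvec z) :=
    fun y => hlin (PowerSeries.C y) z (Submodule.mem_span_singleton_self z)
  -- the values identity and `𝔯̃_e ≠ 0`
  obtain ⟨δ, U, hδ0, hEV⟩ := StationR.values_identity g ι Ω hss ha hκ hγ hcv π F z c' w q μt hND hBK hVAL e he hlin'
  have hrt := rtilde_ne_zero g ι Ω hss ha hκ hγ hcv hPP π F z c' w q μt hq0 hμ0 hND hBK hVAL e he hlin'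
  set rt : IwasawaAlgebraO (Set.range ι) := ∑ i : Fin n, PowerSeries.C (c' i) * e (Pi.single i 1) with hrtdef
  -- the enlarged coefficient ring `𝒪_{S′}`, `S′ = range ι ∪ {q}`, and the integral constant `u = 2^a · 3 q δ`
  haveI : FiniteDimensional ℚ_[2] ↥(padicCoeffField (Set.range ι ∪ {q})) := finiteDimensional_padicCoeffField_range_union_singleton ι q
  have hO : padicCoeffIntegers (Set.range ι) ≤ padicCoeffIntegers (Set.range ι ∪ {q}) :=
    MazurTateValuesRelay.padicCoeffIntegers_mono Set.subset_union_left
  have hmem : 3 * q * (δ : PadicAlgCl 2) ∈ padicCoeffField (Set.range ι ∪ {q}) := by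
    refine mul_mem (mul_mem ?_ (MazurTateValuesRelay.mem_padicCoeffField_union_singleton _ q)) ?_
    · exact_mod_cast (natCast_mem (padicCoeffField (Set.range ι ∪ {q})) 3)
    · exact IntermediateField.adjoin.mono ℚ_[2] _ _ Set.subset_union_left δ.2
  obtain ⟨a, ha⟩ := MazurTateValuesRelay.exists_natCast_pow_mul_mem_padicCoeffIntegers hmem
  have hu : (⟨_, ha⟩ : ↥(padicCoeffIntegers (Set.range ι ∪ {q}))) ≠ 0 := by
    intro h0
    have h1 : (2 : PadicAlgCl 2) ^ a * (3 * q * (δ : PadicAlgCl 2)) = 0 := by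
      have := congrArg (fun x : ↥(padicCoeffIntegers (Set.range ι ∪ {q})) => (x : PadicAlgCl 2)) h0
      simpa using this
    have hδ' : (δ : PadicAlgCl 2) ≠ 0 := by exact_mod_cast hδ0
    exact mul_ne_zero (pow_ne_zero _ two_ne_zero) (mul_ne_zero (mul_ne_zero three_ne_zero hq0) hδ') h1
  -- the socket
  have hν0 : ((2 : ↥(padicCoeffIntegers (Set.range ι))) ^ a) ≠ 0 := by
    intro h0
    have h1 := congrArg (fun x : ↥(padicCoeffIntegers (Set.range ι)) => (x : PadicAlgCl 2)) h0
    have h22 : (((2 : ↥(padicCoeffIntegers (Set.range ι)))) : PadicAlgCl 2) = 2 := rfl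
    simp only [SubmonoidClass.coe_pow, ZeroMemClass.coe_zero, h22] at h1
    exact pow_ne_zero _ two_ne_zero h1
  have hEVC : ∃ (ν : ↥(padicCoeffIntegers (Set.range ι))) (w' : IwasawaAlgebraO (Set.range ι)), ν ≠ 0 ∧ IsUnit w' ∧
      ∃ m₀ : ℕ, ∀ m : ℕ, m₀ ≤ m → ∀ ζ : ℂ_[2], IsPrimitiveRoot ζ (2 ^ (2 * m)) →
        ((algebraMap (PadicAlgCl 2) ℂ_[2]).comp (padicCoeffIntegers (Set.range ι ∪ {q})).subtype) ⟨_, ha⟩ *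
          (∑' k, ((algebraMap (PadicAlgCl 2) ℂ_[2]).comp (padicCoeffIntegers (Set.range ι)).subtype)
            (PowerSeries.coeff k (rt * μt)) * (ζ - 1) ^ k) *
          ((mazurTateElementK g Ω 2 (2 * m)).map ι).eval₂ (algebraMap (PadicAlgCl 2) ℂ_[2]) (ζ - 1) =
        -(((-1 : ℤ[X]) ^ m * cyclotomicOmegaMinus 2 (2 * m)).eval₂ (Int.castRingHom ℂ_[2]) (ζ - 1)) *
          ∑' k, ((algebraMap (PadicAlgCl 2) ℂ_[2]).comp (padicCoeffIntegers (Set.range ι)).subtype)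
            (PowerSeries.coeff k (PowerSeries.C ν * w' * e (π.cvec z))) * (ζ - 1) ^ k := by
    refine ⟨(2 : ↥(padicCoeffIntegers (Set.range ι))) ^ a, PowerSeries.map (padicIntToCoeffIntegers (Set.range ι)) (U : PowerSeries ℤ_[2]),
      hν0, (U.map (PowerSeries.map (padicIntToCoeffIntegers (Set.range ι))).toMonoidHom).isUnit, 1, fun m hm ζ hζ => ?_⟩
    have h := hEV m hm ζ hζ
    have h2a : ((algebraMap (PadicAlgCl 2) ℂ_[2]).comp (padicCoeffIntegers (Set.range ι ∪ {q})).subtype) ⟨_, ha⟩ =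
        (2 : ℂ_[2]) ^ a * algebraMap (PadicAlgCl 2) ℂ_[2] (3 * q * (δ : PadicAlgCl 2)) := by
      show algebraMap (PadicAlgCl 2) ℂ_[2] ((2 : PadicAlgCl 2) ^ a * (3 * q * (δ : PadicAlgCl 2))) = _
      rw [map_mul, map_pow, map_ofNat]
    have hC : PowerSeries.C ((2 : ↥(padicCoeffIntegers (Set.range ι))) ^ a) *
        PowerSeries.map (padicIntToCoeffIntegers (Set.range ι)) (U : PowerSeries ℤ_[2]) * e (π.cvec z) =
        PowerSeries.C ((2 : ↥(padicCoeffIntegers (Set.range ι))) ^ a) *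
          (PowerSeries.map (padicIntToCoeffIntegers (Set.range ι)) (U : PowerSeries ℤ_[2]) * e (π.cvec z)) := by ring
    have h2 : algebraMap (PadicAlgCl 2) ℂ_[2] ((((2 : ↥(padicCoeffIntegers (Set.range ι))) ^ a : ↥(padicCoeffIntegers (Set.range ι))) :
        PadicAlgCl 2)) = (2 : ℂ_[2]) ^ a := by
      have h22 : (((2 : ↥(padicCoeffIntegers (Set.range ι)))) : PadicAlgCl 2) = 2 := rfl
      rw [SubmonoidClass.coe_pow, map_pow, h22, map_ofNat]
    rw [h2a, hC, StationR.tsum_C_mul_eval, h2]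
    linear_combination (2 : ℂ_[2]) ^ a * h
  obtain ⟨u₀, ν, u', hu₀, hν, hu', hrel⟩ := StationR.Road.hERL_of_scaledColumnValues hO hPP (e (π.cvec z)) (rt * μt)
    (mul_ne_zero hrt hμ0) ⟨_, ha⟩ hEVC
  have hu₀' : u₀ ≠ 0 := by
    rintro rfl
    apply hu
    have h0 : ((⟨_, ha⟩ : ↥(padicCoeffIntegers (Set.range ι ∪ {q}))) : PadicAlgCl 2) = 0 := by
      rw [← hu₀]
      simp
    exact_mod_cast h0
  refine ⟨ν, u₀, u', hν, hu₀', hu', ?_⟩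
  rw [hrel]
  ring

/-! ## §H  (E′) — station (E) re-exported IN THE COEFFICIENTWISE GAUGE (T97): the basis columns `e(δᵢ)` are constants -/

section Gauge

variable {S : Set (PadicAlgCl 2)} {W : WeierstrassCurve ℚ} [W.IsElliptic] [W.IsGloballyMinimal] {κ : ZpExtension ℚ 2}
  {γ : absoluteGaloisGroup ℚ} {S₀ : Finset (HeightOneSpectrum (𝓞 ℚ))} {n : ℕ} {ρ : FramedGaloisRep ℚ ↥(padicCoeffIntegers S) 2}
  {Θ : ∀ v : HeightOneSpectrum (𝓞 ℚ), ((2 : ℕ) : 𝓞 ℚ) ∈ v.asIdeal → (Cofree ρ ↥(padicCoeffField S) ≃+ (Fin n → ↥(W.geomPrimaryTorsion 2)))}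
  {hΘ : ∀ v hv (δ : absoluteGaloisGroup (v.adicCompletion ℚ)) m i,
    Θ v hv (resGalOfEmb (closureEmb (K := ℚ) (v.adicCompletion ℚ)) δ • m) i = resGalOfEmb (closureEmb (K := ℚ) (v.adicCompletion ℚ)) δ • Θ v hv m i}
  {I : Kato2004.IwasawaH1DataCoeff (FramedGaloisRep.toGaloisRep ρ) 2 κ γ}
  {Sg : AddSubgroup (subgroupH1 κ.kerSubgroup (Cofree ρ ↥(padicCoeffField S)))} [Module ↥(padicCoeffIntegers S) ↥Sg]

set_option maxHeartbeats 800000 in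
/-- **(E′) `exists_trivialisation_coeffwise` (PROVED; the landed `OnePairPins.exists_trivialisation` p722652 with its `e` NOT forgotten).**
Station (E) at the pins, GLOBAL form, plus the GAUGE clause `∀ i, ∃ b, e (δᵢ) = C b` that T97 requires of any (B≡) statement: the landed proof
already builds `e` by `PriceNode.exists_coeffwise_addEquiv Φ`, so `e (δᵢ) = C (Φ⁻¹ δᵢ)` (§E `single_eq_C_of_coeffwise`). Same inputs
(LIN-X `cvec_map_X_smul`, LIN-𝒪 `exists_thetaMatrixRingHom_cvec_C_smul`, LATTICE `exists_equivariant_addEquiv` / `htf_of_norm`).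
[cite: Washington1997, §7.1, §13.2] [cite: Kato2004Asterisque, Thm. 12.5 (1) (p. 221), §13.8 (pp. 228–229)] -/
theorem exists_trivialisation_coeffwise [FiniteDimensional ℚ_[2] ↥(padicCoeffField S)] (π : OnePairPins S W κ γ S₀ n ρ Θ hΘ I Sg)
    (hss : GoodSS W 2) (ha2 : W.frobeniusTrace 2 = 0) (hγ : κ.IsTopGenerator γ) :
    ∃ e : (Fin n → PowerSeries ℤ_[2]) ≃+ IwasawaAlgebraO S,
      (∀ (r : PowerSeries ℤ_[2]) (t : Fin n → PowerSeries ℤ_[2]), e (r • t) = PowerSeries.map (padicIntToCoeffIntegers S) r * e t) ∧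
      (∀ (s : IwasawaAlgebraO S) (x : I.H), e (π.cvec (s • x)) = s * e (π.cvec x)) ∧
      ∀ i : Fin n, ∃ b : ↥(padicCoeffIntegers S), e (Pi.single i 1) = PowerSeries.C b := by
  haveI : IsDiscreteValuationRing ↥(padicCoeffIntegers S) := PollackPairK.isDiscreteValuationRing_padicCoeffIntegers
  -- the ring hom `A` and LIN-𝒪
  obtain ⟨A, hAι, hO⟩ := π.exists_thetaMatrixRingHom_cvec_C_smul W hss ha2
  -- the lattice `Φ`
  obtain ⟨B, hB⟩ := π.exists_addEquiv_pi_fin_n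
  obtain ⟨Φ, hΦA, hΦι⟩ := PriceNode.exists_equivariant_addEquiv (padicIntToCoeffIntegers S) (StationE.pos_of_addEquiv_pi B) B hB A hAι
    (PriceNode.htf_of_norm (padicIntToCoeffIntegers S) A hAι StationE.exists_mul_eq_padicInt_pow_of_ne_zero)
  -- `𝒸` as an additive map, LIN-X, LIN-𝒪
  obtain ⟨𝒸, h𝒸⟩ := π.exists_cvecHom
  have hX : ∀ x ∈ (⊤ : Submodule (IwasawaAlgebraO S) I.H),
      𝒸 ((PowerSeries.X : IwasawaAlgebraO S) • x) = (PowerSeries.X : PowerSeries ℤ_[2]) • 𝒸 x := fun x _ ↦ by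
    have h := π.cvec_map_X_smul hγ x
    rw [PowerSeries.map_X] at h
    rw [h𝒸, h𝒸, h]
  have hO' : ∀ (a : ↥(padicCoeffIntegers S)), ∀ x ∈ (⊤ : Submodule (IwasawaAlgebraO S) I.H),
      𝒸 ((PowerSeries.C a : IwasawaAlgebraO S) • x) = fun i ↦ ∑ j, (PowerSeries.C (A a i j) : PowerSeries ℤ_[2]) * 𝒸 x j := fun a x _ ↦ by
    rw [h𝒸, h𝒸, hO a x]
  -- the coefficientwise `e` of `Φ`, kept in hand
  obtain ⟨e, he⟩ := PriceNode.exists_coeffwise_addEquiv (R := ℤ_[2]) Φ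
  refine ⟨e, PriceNode.coeffwise_smul Φ e he (padicIntToCoeffIntegers S) hΦι, fun s x ↦ ?_, fun i ↦ ⟨Φ.symm (Pi.single i 1), ?_⟩⟩
  · rw [← h𝒸, ← h𝒸]
    exact PriceNode.semilinear_on_submodule 𝒸 ⊤ A Φ hΦA e he hX hO' s x Submodule.mem_top
  · exact Summit.BirchSwinnertonDyer.BirchSwinnertonDyer.Cruxes.ResidualThetaCountLowerPureAtTwo.SideaK3G30.single_eq_C_of_coeffwise Φ e he i

end Gauge

end Summit.BirchSwinnertonDyer.BirchSwinnertonDyer.Theorems.OnePair.SideaK3G30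

end
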